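import Literature.Analysis.FunctionSpaces.LatticeGreenKernel
import Literature.Analysis.FunctionSpaces.TorusFourierCalculus
import Literature.Analysis.FunctionSpaces.TorusReflectionCalculus
import HarnessLib

/-!
# B3 — T. Bałaban, *(Higgs)₂,₃ quantum fields in a finite volume. III. Renormalization*, CMP **88** (1983) 411–445
[Balaban1983Higgs3], p. 442 [PDF 32]: the **zero-momentum Ward identity** for the symbol σ_ξ of the free propagator
C^ξ = (−Δ^ξ + 1)^{−1} on the dual torus T^d — the analytic core of *"the expression in the square bracket [of (3.29)] has
exactly the form appearing in the Ward-Takahashi identity (2.26) with M² = 1, hence it is equal to 0"* — PROVED (file 1/2;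
file 2/2 `B3Eq329WardVanishing` turns it into the vanishing of the (3.29) bracket on ξℤ^d by Plancherel)

statement-level skeleton of published theorems with citation tags; proofs where landed; nothing here is a claim about
the Yang–Mills mass gap

PDF held: `paper:balaban1983-higgs-2-3-quantum-fields-finite-volume` (journal page = PDF page + 410).  Read: pp. 437, 440–442
[PDF 27, 30–32] on the ×2 renders `run/shared/lean/pub/pub-balaban/b2b-balaban-ref1/pages/1983-cmp88-higgs23-III/…-p0NN-x2.png`.

CITATION HEADER (lean-in-tree rule).  Part of the lit-balaban TYPED SKELETON (HOME `run/shared/lean/pub/lit-balaban/`), PHASE 2,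
proof seat p20 (generation 3); row **B3.Eq3.25-3.32** of `HOME/lit-balaban-r15/ROWS-B3.md` (fold owner r15), member *"the
WT-vanishing of (3.29)"*.  WHAT IS HERE (all on Mathlib's `UnitAddTorus (Fin d)` with the tree's global-`volume` torus calculus
`Literature.Analysis.FunctionSpaces.{FlatTorus, TorusCalculus, TorusFourierCalculus, TorusReflectionCalculus}`):
* §2 the symbol σ_ξ(θ) = (ξ^{−2}μ(θ) + 1)^{−1} of C^ξ ((3.16) p. 437: C^ξ = (−Δ^ξ + 1)^{−1}; μ = `latticeDispersion`, the function of
  `B3Eq324Parseval.mFourierCoeff_symb`) as a complex function `symb`, the characters e_{±μ} = `U`/`Ub` (Mathlib `mFourier (±e_μ)`),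
  μ(θ) = Σ_i(2 − e_i − e_{−i}) (`disp`, `latticeDispersion_eq_disp`), σ_ξ = (ξ^{−2}μ + 1)^{−1} (`symb_eq`), continuity, reality,
  smoothness (`isSmooth_symb`: `Torus.IsSmooth`, via `ContDiff.inv`);
* §3 the coordinate reflection θ_ν ↦ −θ_ν as the integer lattice automorphism `reflMat ν` (`Torus.mulVecT`): e_{±μ}∘R_ν = e_{±μ}
  (μ ≠ ν), e_{±ν}∘R_ν = e_{∓ν}, σ_ξ∘R_ν = σ_ξ, ∫_{T^d} g∘R_ν = ∫ g (`integral_reflMat`, from `Torus.integral_comp_mulVecT_of_mul_eq_one`);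
* §4 the line derivatives ∂_μe_{±μ} = ±2πie_{±μ}, ∂_μμ = −2πi(e_μ − e_{−μ}), ∂_μσ_ξ = 2πiξ^{−2}(e_μ − e_{−μ})σ_ξ², the smooth
  function F_μ = (e_μ − e_{−μ})σ_ξ (`wardFn`) with ∂_μF_μ = 2πi[(e_μ + e_{−μ})σ_ξ + ξ^{−2}(e_μ − e_{−μ})²σ_ξ²] (`partialDeriv_wardFn`) and
  **`integral_ward`**: ∫_{T^d}(e_μ + e_{−μ})σ_ξ + ξ^{−2}∫_{T^d}(e_μ − e_{−μ})²σ_ξ² = 0 (`Torus.integral_partialDeriv_eq_zero_holds`), i.e.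
  ξ²∫cos(2πθ_μ)σ_ξ(θ)dθ = 2∫sin²(2πθ_μ)σ_ξ(θ)²dθ — the μ = μ′, zero-momentum instance of the photon self-energy Ward identity
  that p. 442 invokes through (2.26) with λ(y′) = Σ_{μ′}c_{μ′}y′_{μ′}.
No new named fact; definitions with bodies + theorems; standard axioms.  Unit `lit-balaban-p20` (literature-prover-lit-balaban-p20-g3-0),
2026-08-21; HOME/FILED.md records the proposal.
-/

open MeasureTheory Set Filter UnitAddTorus
open scoped BigOperators ComplexConjugate ContDiff

namespace Literature.MathematicalPhysics.QuantumFieldTheory.Balaban1983to89.B3Eq329TorusWard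

open Literature.Analysis.FunctionSpaces Literature.Analysis.FunctionSpaces.LatticeFourier
open Literature.Analysis.FunctionSpaces.Torus

noncomputable section

variable {d : ℕ} {ξ : ℝ}

/-! ## 2. The symbol σ_ξ and the characters e_{±μ} on the dual torus T^d -/

/-- σ_ξ(θ) = (ξ^{−2}μ(θ) + 1)^{−1}, the symbol of C^ξ on the unit torus (μ = `latticeDispersion`), as a complex function
(the function of `B3Eq324Parseval.mFourierCoeff_symb`). [cite: Balaban1983Higgs3, (3.16) p.437] -/
def symb (ξ : ℝ) (θ : UnitAddTorus (Fin d)) : ℂ := (((ξ⁻¹ ^ 2 * latticeDispersion θ + 1)⁻¹ : ℝ) : ℂ)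

/-- the character e_μ(θ) = exp(2πiθ_μ) of T^d. [folklore] -/
def U (μ : Fin d) (θ : UnitAddTorus (Fin d)) : ℂ := mFourier (Pi.single μ (1 : ℤ)) θ

/-- the character e_{−μ}(θ) = exp(−2πiθ_μ) = conj e_μ(θ) of T^d. [folklore] -/
def Ub (μ : Fin d) (θ : UnitAddTorus (Fin d)) : ℂ := mFourier (-Pi.single μ (1 : ℤ)) θ

/-- μ(θ) = Σ_i (2 − e_i(θ) − e_{−i}(θ)), the lattice dispersion written in the characters. [folklore] -/
def disp (θ : UnitAddTorus (Fin d)) : ℂ := ∑ i : Fin d, (2 - U i θ - Ub i θ)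

/-- kernel: e_μ e_{−μ} = 1. [folklore] -/
private theorem U_mul_Ub (μ : Fin d) (θ : UnitAddTorus (Fin d)) : U μ θ * Ub μ θ = 1 := by
  rw [U, Ub, ← mFourier_add, add_neg_cancel, mFourier_zero]; rfl

/-- kernel: conj e_μ = e_{−μ}, conj e_{−μ} = e_μ (the p. 441 identities C^ξ(−y) = C^ξ(y), (∂^ξ_μC^ξ)(−y) = (∂^{ξ*}_μC^ξ)(y) on the
dual torus). [cite: Balaban1983Higgs3, (3.27) p.441] -/
theorem conj_U (μ : Fin d) (θ : UnitAddTorus (Fin d)) : conj (U μ θ) = Ub μ θ ∧ conj (Ub μ θ) = U μ θ := by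
  refine ⟨?_, ?_⟩
  · rw [U, Ub, mFourier_neg]
  · rw [U, Ub, mFourier_neg, Complex.conj_conj]

/-- kernel: the character e_μ is continuous. [cite: Balaban1983Higgs3, (3.29) p.441] -/
@[fun_prop]
theorem continuous_U (μ : Fin d) : Continuous (U (d := d) μ) := (mFourier _).continuous

/-- kernel: the character e_{−μ} is continuous. [cite: Balaban1983Higgs3, (3.29) p.441] -/
@[fun_prop]
theorem continuous_Ub (μ : Fin d) : Continuous (Ub (d := d) μ) := (mFourier _).continuous

/-- kernel: μ(θ) in the characters: ‖e_i(θ) − 1‖² = 2 − e_i(θ) − e_{−i}(θ). [folklore] -/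
private theorem latticeDispersion_eq_disp (θ : UnitAddTorus (Fin d)) : (latticeDispersion θ : ℂ) = disp θ := by
  unfold latticeDispersion disp
  push_cast
  refine Finset.sum_congr rfl fun i _ => ?_
  rw [← mFourier_single, ← Complex.conj_mul', map_sub, map_one, ← mFourier_neg]
  have h := U_mul_Ub i θ
  rw [U, Ub] at h
  rw [U, Ub]
  linear_combination h

/-- kernel: the real denominator is positive. [folklore] -/
private theorem den_pos (ξ : ℝ) (θ : UnitAddTorus (Fin d)) : 0 < ξ⁻¹ ^ 2 * latticeDispersion θ + 1 :=
  add_pos_of_nonneg_of_pos (mul_nonneg (sq_nonneg _) (latticeDispersion_nonneg θ)) one_pos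

/-- kernel: the complex denominator does not vanish. [folklore] -/
private theorem denC_ne_zero (ξ : ℝ) (θ : UnitAddTorus (Fin d)) : ((ξ : ℂ)⁻¹) ^ 2 * disp θ + 1 ≠ 0 := by
  rw [← latticeDispersion_eq_disp]
  have h := (den_pos ξ θ).ne'
  exact_mod_cast h

/-- σ_ξ = (ξ^{−2}μ + 1)^{−1} in the characters. [folklore] -/
private theorem symb_eq (ξ : ℝ) (θ : UnitAddTorus (Fin d)) : symb ξ θ = (((ξ : ℂ)⁻¹) ^ 2 * disp θ + 1)⁻¹ := by
  unfold symb
  rw [← latticeDispersion_eq_disp]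
  push_cast
  rfl

/-- kernel: σ_ξ is real, conj σ_ξ = σ_ξ (C^ξ is a real kernel). [cite: Balaban1983Higgs3, (3.16) p.437] -/
theorem conj_symb (ξ : ℝ) (θ : UnitAddTorus (Fin d)) : conj (symb ξ θ) = symb ξ θ := by
  unfold symb; exact Complex.conj_ofReal _

/-- kernel: σ_ξ is continuous on T^d (Δ^ξ(p) + 1 ≥ 1). [cite: Balaban1983Higgs3, (3.16) p.437] -/
@[fun_prop]
theorem continuous_symb (ξ : ℝ) : Continuous (symb (d := d) ξ) :=
  Complex.continuous_ofReal.comp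
    (((continuous_const.mul continuous_latticeDispersion).add continuous_const).inv₀ fun θ => (den_pos ξ θ).ne')

/-- kernel: the characters are smooth. [folklore] -/
private theorem isSmooth_U (μ : Fin d) : IsSmooth (U (d := d) μ) ∧ IsSmooth (Ub (d := d) μ) :=
  ⟨isSmooth_mFourier _, isSmooth_mFourier _⟩

/-- kernel: μ is smooth (a trigonometric polynomial). [folklore] -/
private theorem isSmooth_disp : IsSmooth (disp : UnitAddTorus (Fin d) → ℂ) := by
  unfold IsSmooth
  show ContDiff ℝ ∞ (fun x => ∑ i : Fin d, (2 - Torus.lift (U i) x - Torus.lift (Ub i) x))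
  exact ContDiff.sum fun i _ => (contDiff_const.sub (isSmooth_U i).1).sub (isSmooth_U i).2

/-- kernel: σ_ξ is smooth. [folklore] -/
private theorem isSmooth_symb (ξ : ℝ) : IsSmooth (symb (d := d) ξ) := by
  have h : symb (d := d) ξ = fun θ => (((ξ : ℂ)⁻¹) ^ 2 * disp θ + 1)⁻¹ := funext (symb_eq ξ)
  rw [h]
  unfold IsSmooth
  show ContDiff ℝ ∞ (fun x => (((ξ : ℂ)⁻¹) ^ 2 * Torus.lift disp x + 1)⁻¹)
  exact ContDiff.inv ((contDiff_const.mul isSmooth_disp).add contDiff_const) fun x => denC_ne_zero ξ _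

/-! ## 3. The coordinate reflection θ_ν ↦ −θ_ν of T^d -/

/-- the reflection of the ν-th coordinate as an integer diagonal matrix. [folklore] -/
def reflMat (ν : Fin d) : Matrix (Fin d) (Fin d) ℤ := Matrix.diagonal fun i => if i = ν then -1 else 1

/-- kernel: the reflection is an involution. [folklore] -/
private theorem reflMat_mul_self (ν : Fin d) : reflMat ν * reflMat ν = 1 := by
  rw [reflMat, Matrix.diagonal_mul_diagonal, ← Matrix.diagonal_one]
  congr 1
  funext i
  split_ifs <;> norm_num

/-- kernel: coordinates of the reflected point. [folklore] -/
private theorem mulVecT_reflMat_apply (ν : Fin d) (θ : UnitAddTorus (Fin d)) (i : Fin d) :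
    mulVecT (reflMat ν) θ i = if i = ν then -θ i else θ i := by
  rw [mulVecT_apply]
  simp only [reflMat, Matrix.diagonal_apply, ite_smul, zero_smul, Finset.sum_ite_eq, Finset.mem_univ, if_true]
  split_ifs
  · exact neg_one_zsmul _
  · exact one_zsmul _

/-- kernel: characters under the reflection, e_m(R_νθ) = e_{m′}(θ), m′_j = ∓m_j. [folklore] -/
private theorem mFourier_reflMat (m : Fin d → ℤ) (ν : Fin d) (θ : UnitAddTorus (Fin d)) :
    mFourier m (mulVecT (reflMat ν) θ) = mFourier (fun j => if j = ν then -m j else m j) θ := by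
  have h : Matrix.vecMul m (reflMat ν) = fun j => if j = ν then -m j else m j := by
    funext j
    rw [reflMat, Matrix.vecMul_diagonal]
    split_ifs <;> ring
  rw [mFourier_mulVecT, h]

/-- kernel: e_{±μ}(R_νθ) = e_{±μ}(θ) for μ ≠ ν (the reflection p_ν ↦ −p_ν of the Brillouin box used for (3.28)/(3.29)).
[cite: Balaban1983Higgs3, (3.28) p.441] -/
theorem U_reflMat_ne {μ ν : Fin d} (h : μ ≠ ν) (θ : UnitAddTorus (Fin d)) :
    U μ (mulVecT (reflMat ν) θ) = U μ θ ∧ Ub μ (mulVecT (reflMat ν) θ) = Ub μ θ := by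
  have hm : ∀ c : ℤ, (fun j => if j = ν then -(Pi.single μ c : Fin d → ℤ) j else (Pi.single μ c : Fin d → ℤ) j) =
      (Pi.single μ c : Fin d → ℤ) := by
    intro c
    funext j
    by_cases hj : j = ν
    · subst hj; simp [Ne.symm h]
    · simp [hj]
  have hneg : (-Pi.single μ (1 : ℤ) : Fin d → ℤ) = Pi.single μ (-1 : ℤ) := by
    funext j
    by_cases hj : j = μ
    · subst hj; simp
    · simp [hj]
  refine ⟨?_, ?_⟩
  · simp only [U]; rw [mFourier_reflMat, hm]
  · simp only [Ub]; rw [hneg, mFourier_reflMat, hm]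

/-- kernel: e_{±ν}(R_νθ) = e_{∓ν}(θ) (the reflection p_ν ↦ −p_ν of the Brillouin box). [cite: Balaban1983Higgs3, (3.28) p.441] -/
theorem U_reflMat_self (ν : Fin d) (θ : UnitAddTorus (Fin d)) :
    U ν (mulVecT (reflMat ν) θ) = Ub ν θ ∧ Ub ν (mulVecT (reflMat ν) θ) = U ν θ := by
  have hm : ∀ c : ℤ, (fun j => if j = ν then -(Pi.single ν c : Fin d → ℤ) j else (Pi.single ν c : Fin d → ℤ) j) =
      (Pi.single ν (-c) : Fin d → ℤ) := by
    intro c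
    funext j
    by_cases hj : j = ν
    · subst hj; simp
    · simp [hj]
  have hneg : (-Pi.single ν (1 : ℤ) : Fin d → ℤ) = Pi.single ν (-1 : ℤ) := by
    funext j
    by_cases hj : j = ν
    · subst hj; simp
    · simp [hj]
  refine ⟨?_, ?_⟩
  · rw [U, Ub, mFourier_reflMat, hm, hneg]
  · rw [U, Ub, hneg, mFourier_reflMat, hm, neg_neg]

/-- kernel: the lattice dispersion is reflection invariant. [folklore] -/
private theorem latticeDispersion_reflMat (ν : Fin d) (θ : UnitAddTorus (Fin d)) :
    latticeDispersion (mulVecT (reflMat ν) θ) = latticeDispersion θ := by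
  unfold latticeDispersion
  refine Finset.sum_congr rfl fun i _ => ?_
  rw [mulVecT_reflMat_apply]
  split_ifs
  · rw [fourier_neg_arg, show (starRingEnd ℂ) (fourier 1 (θ i)) - 1 = (starRingEnd ℂ) (fourier 1 (θ i) - 1) by
      rw [map_sub, map_one], Complex.norm_conj]
  · rfl

/-- kernel: σ_ξ is reflection invariant (Δ^ξ(p) is even in each p_ν). [cite: Balaban1983Higgs3, (3.28) p.441] -/
theorem symb_reflMat (ξ : ℝ) (ν : Fin d) (θ : UnitAddTorus (Fin d)) :
    symb ξ (mulVecT (reflMat ν) θ) = symb ξ θ := by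
  unfold symb; rw [latticeDispersion_reflMat]

/-- kernel: integrals over T^d are invariant under p_ν ↦ −p_ν (`Torus.integral_comp_mulVecT_of_mul_eq_one`; the symmetry of the
Brillouin box used for (3.28), cf. r15's `integral328_offDiag`). [cite: Balaban1983Higgs3, (3.28) p.441] -/
theorem integral_reflMat (ν : Fin d) (g : UnitAddTorus (Fin d) → ℂ) :
    ∫ θ, g (mulVecT (reflMat ν) θ) = ∫ θ, g θ :=
  integral_comp_mulVecT_of_mul_eq_one (reflMat_mul_self ν) g

/-! ## 4. Derivatives along the coordinate line and the integration by parts -/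

section LineDerivatives

variable (μ : Fin d) (x : UnitAddTorus (Fin d))

/-- kernel: d/dt e_m(x + t e_μ)|₀ = 2πi m_μ e_m(x) (as in `Torus.partialDeriv_mFourier`). [folklore] -/
private theorem hasDerivAt_mFourier_line (m : Fin d → ℤ) :
    HasDerivAt (fun t : ℝ => mFourier m (x + proj (t • EuclideanSpace.single μ (1 : ℝ))))
      (2 * Real.pi * Complex.I * (m μ) * mFourier m x) 0 := by
  have hline : (fun t : ℝ => mFourier m (x + proj (t • EuclideanSpace.single μ (1 : ℝ)))) =
      fun t : ℝ => mFourier m x * fourier (m μ) (t : UnitAddCircle) := by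
    funext t
    rw [mFourier_apply_add, mFourier_proj_smul_single]
  rw [hline]
  refine ((hasDerivAt_fourier 1 (m μ) 0).const_mul (mFourier m x)).congr_deriv ?_
  simp only [Complex.ofReal_one, div_one, QuotientAddGroup.mk_zero, fourier_eval_zero, mul_one]
  ring

/-- kernel: d/dt e_μ(x + t e_μ)|₀ = 2πi e_μ(x). [folklore] -/
private theorem hasDerivAt_U_line :
    HasDerivAt (fun t : ℝ => U μ (x + proj (t • EuclideanSpace.single μ (1 : ℝ))))
      (2 * Real.pi * Complex.I * U μ x) 0 := by
  refine (hasDerivAt_mFourier_line μ x (Pi.single μ 1)).congr_deriv ?_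
  rw [U, Pi.single_eq_same, Int.cast_one, mul_one]

/-- kernel: d/dt e_{−μ}(x + t e_μ)|₀ = −2πi e_{−μ}(x). [folklore] -/
private theorem hasDerivAt_Ub_line :
    HasDerivAt (fun t : ℝ => Ub μ (x + proj (t • EuclideanSpace.single μ (1 : ℝ))))
      (-(2 * Real.pi * Complex.I) * Ub μ x) 0 := by
  refine (hasDerivAt_mFourier_line μ x (-Pi.single μ 1)).congr_deriv ?_
  rw [Ub, Pi.neg_apply, Pi.single_eq_same, Int.cast_neg, Int.cast_one]
  ring

/-- kernel: d/dt μ(x + t e_μ)|₀ = −2πi(e_μ(x) − e_{−μ}(x)). [folklore] -/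
private theorem hasDerivAt_disp_line :
    HasDerivAt (fun t : ℝ => disp (x + proj (t • EuclideanSpace.single μ (1 : ℝ))))
      (-(2 * Real.pi * Complex.I) * (U μ x - Ub μ x)) 0 := by
  unfold disp
  refine (HasDerivAt.fun_sum (u := (Finset.univ : Finset (Fin d)))
    (A := fun i (t : ℝ) => (2 : ℂ) - U i (x + proj (t • EuclideanSpace.single μ (1 : ℝ)))
      - Ub i (x + proj (t • EuclideanSpace.single μ (1 : ℝ))))
    (fun i _ => ((hasDerivAt_const (0 : ℝ) (2 : ℂ)).sub (hasDerivAt_mFourier_line μ x (Pi.single i 1))).sub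
      (hasDerivAt_mFourier_line μ x (-Pi.single i 1)))).congr_deriv ?_
  rw [Finset.sum_eq_single μ]
  · simp only [U, Ub, Pi.single_eq_same, Pi.neg_apply, Int.cast_neg, Int.cast_one]
    ring
  · intro i _ hi
    simp [Ne.symm hi]
  · intro h; exact absurd (Finset.mem_univ μ) h

/-- kernel: d/dt σ_ξ(x + t e_μ)|₀ = 2πiξ^{−2}(e_μ(x) − e_{−μ}(x))σ_ξ(x)². [folklore] -/
private theorem hasDerivAt_symb_line (ξ : ℝ) :
    HasDerivAt (fun t : ℝ => symb ξ (x + proj (t • EuclideanSpace.single μ (1 : ℝ))))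
      (-(((ξ : ℂ)⁻¹) ^ 2 * (-(2 * Real.pi * Complex.I) * (U μ x - Ub μ x))) /
        ((((ξ : ℂ)⁻¹) ^ 2 * disp x + 1) ^ 2)) 0 := by
  have hfun : (fun t : ℝ => symb ξ (x + proj (t • EuclideanSpace.single μ (1 : ℝ)))) =
      fun t => ((((ξ : ℂ)⁻¹) ^ 2 * disp (x + proj (t • EuclideanSpace.single μ (1 : ℝ))) + 1)⁻¹) :=
    funext fun t => symb_eq ξ _
  rw [hfun]
  have h := ((hasDerivAt_disp_line μ x).const_mul (((ξ : ℂ)⁻¹) ^ 2)).add_const 1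
  have h0 : (((ξ : ℂ)⁻¹) ^ 2 * disp (x + proj ((0 : ℝ) • EuclideanSpace.single μ (1 : ℝ))) + 1) ≠ 0 := by
    simp only [zero_smul, proj_zero, add_zero]
    exact denC_ne_zero ξ x
  have h2 := h.inv h0
  simp only [zero_smul, proj_zero, add_zero] at h2
  exact h2

/-- The function to which the integration by parts is applied: F_μ = (e_μ − e_{−μ})σ_ξ (= 2i sin(2πθ_μ)σ_ξ(θ)).
[folklore] -/
def wardFn (ξ : ℝ) (μ : Fin d) (θ : UnitAddTorus (Fin d)) : ℂ := (U μ θ - Ub μ θ) * symb ξ θ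

/-- kernel: F_μ is smooth. [folklore] -/
private theorem isSmooth_wardFn (ξ : ℝ) (μ : Fin d) : IsSmooth (wardFn (d := d) ξ μ) := by
  unfold IsSmooth wardFn
  show ContDiff ℝ ∞ (fun v => (Torus.lift (U μ) v - Torus.lift (Ub μ) v) * Torus.lift (symb ξ) v)
  exact ((isSmooth_U μ).1.sub (isSmooth_U μ).2).mul (isSmooth_symb ξ)

/-- kernel: the partial derivative of F_μ: ∂_μF_μ = 2πi[(e_μ + e_{−μ})σ_ξ + ξ^{−2}(e_μ − e_{−μ})²σ_ξ²]. [folklore] -/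
private theorem partialDeriv_wardFn (ξ : ℝ) :
    partialDeriv μ (wardFn ξ μ) x = 2 * Real.pi * Complex.I *
      ((U μ x + Ub μ x) * symb ξ x + ((ξ : ℂ)⁻¹) ^ 2 * ((U μ x - Ub μ x) ^ 2 * symb ξ x ^ 2)) := by
  have hF : HasDerivAt (fun t : ℝ => (U μ (x + proj (t • EuclideanSpace.single μ (1 : ℝ))) -
      Ub μ (x + proj (t • EuclideanSpace.single μ (1 : ℝ)))) *
      symb ξ (x + proj (t • EuclideanSpace.single μ (1 : ℝ)))) _ 0 :=
    ((hasDerivAt_U_line μ x).sub (hasDerivAt_Ub_line μ x)).mul (hasDerivAt_symb_line μ x ξ)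
  rw [partialDeriv, Torus.lineDeriv]
  unfold wardFn
  rw [hF.deriv]
  simp only [Pi.sub_apply, zero_smul, proj_zero, add_zero]
  have hD := denC_ne_zero ξ x
  rw [symb_eq]
  field_simp
  ring

/-- **Zero-momentum Ward identity, integrated form**: ∫_{T^d} [(e_μ + e_{−μ})σ_ξ + ξ^{−2}(e_μ − e_{−μ})²σ_ξ²] = 0, i.e.
∫ ∂_μ F_μ = 0 on the torus (`Torus.integral_partialDeriv_eq_zero_holds`); in real form ξ²∫cos(2πθ_μ)σ_ξ = 2∫sin²(2πθ_μ)σ_ξ².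
[cite: Balaban1983Higgs3, (3.29) p.442] -/
theorem integral_ward (ξ : ℝ) (μ : Fin d) :
    (∫ θ : UnitAddTorus (Fin d), (U μ θ + Ub μ θ) * symb ξ θ) +
      ((ξ : ℂ)⁻¹) ^ 2 * ∫ θ : UnitAddTorus (Fin d), (U μ θ - Ub μ θ) ^ 2 * symb ξ θ ^ 2 = 0 := by
  have h0 : ∫ θ : UnitAddTorus (Fin d), partialDeriv μ (wardFn ξ μ) θ = 0 :=
    integral_partialDeriv_eq_zero_holds (isSmooth_wardFn ξ μ) μ
  simp_rw [partialDeriv_wardFn] at h0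
  have i1 : Integrable (fun θ : UnitAddTorus (Fin d) => (U μ θ + Ub μ θ) * symb ξ θ) volume :=
    (((continuous_U μ).add (continuous_Ub μ)).mul (continuous_symb ξ)).integrable_unitAddTorus
  have i2 : Integrable (fun θ : UnitAddTorus (Fin d) => ((ξ : ℂ)⁻¹) ^ 2 * ((U μ θ - Ub μ θ) ^ 2 * symb ξ θ ^ 2))
      volume :=
    (continuous_const.mul ((((continuous_U μ).sub (continuous_Ub μ)).pow 2).mul
      ((continuous_symb ξ).pow 2))).integrable_unitAddTorus
  rw [integral_const_mul, integral_add i1 i2, integral_const_mul] at h0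
  exact (mul_eq_zero.1 h0).resolve_left Complex.two_pi_I_ne_zero

end LineDerivatives

end

end Literature.MathematicalPhysics.QuantumFieldTheory.Balaban1983to89.B3Eq329TorusWard
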